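import Summits.BirchSwinnertonDyer.BirchSwinnertonDyer.Theses.FrozenTwin
import HarnessLib

/-!
# Crux `FrozenTwinBound` (stmt-BirchSwinnertonDyer-17173) — the strategist's typed TAME / WILD split (glue for `route edit --split`)

Glue for the DECOMPOSITION of the crux
`Summit.BirchSwinnertonDyer.BirchSwinnertonDyer.Theses.FrozenTwin.FrozenTwinBound` (route BirchSwinnertonDyer/FrozenTwin,
rank 3: "one integer caps the Selmer corank", `p ∤ M_k ⇒ corank_(ℤ_p) Sel_(p^∞)(E/ℚ) ≤ k` for every admissible frozen-twin
datum) into two regime pieces, filed by the crux-strategist seat (unit `cstrat-stmt-BirchSwinnertonDyer-17173-b1`,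
`Cruxes/FrozenTwinBound/STRATEGY-CENSUS.md`):

* `FrozenTwinBoundTame` — the crux on TAME data: `7 ≤ p`, (PO) `a_p(E)² ≢ 1 (mod p)` (no anomalous prime of `K`
  above `p`: Bertolini–Darmon 1995 assumption (4) / Chida–Hsieh 2015 (PO)), and CAPTURED class-group character: the
  order-`p` character `𝔞 ↦ ζ^(dlog 𝔞)` of `Cl_K` kills the torsion `Δ` of `G̃_∞ = lim Pic(𝒪_(p^n))` (Bertolini–Darmon
  2005 §1.2), i.e. it is a character of the anticyclotomic `ℤ_p`-extension; typed by the explicit criterion: for every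
  representative `𝔟` of `σ` prime to `p` with `𝔟^(p^m) = (t)`, `p^(m+1) ∤ t^(p²-1) - t̄^(p²-1)` in `𝓞_K`
  (`t̄ = c t`, `c` the non-trivial automorphism of `K`).  On tame data the crux is the ORDER-`p`-LAYER SPECIALISATION of
  Bertolini–Darmon 2005 Cor. 3 in Selmer form (anticyclotomic IMC divisibility, Chida–Hsieh 2015 Thm 6.14 /
  Pollack–Weston 2011 Thm 4.1; derived `p`-adic heights, Bertolini–Darmon 1995 Thm 2.23 + Lemma 3.1) — line
  `Cruxes/FrozenTwinBound/Lines/tame-lambda.lean`.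
* `FrozenTwinBoundWild` — the crux on the complementary (WILD) data: anomalous `p`, `p = 5`, or torsion `K`; here only
  the route's own frozen-twin argument (line `birth`) is known to apply.

THEOREM: `FrozenTwinBound_of_subs : FrozenTwinBoundTame → FrozenTwinBoundWild → FrozenTwinBound`, the children spelled
in arrow form verbatim as filed with `route edit --split FrozenTwinBound` (case split on the tame predicate; pure logic).
HONESTY: the conjunction of the children is EQUIVALENT to the crux (a partition of the data), so nothing is lost and
nothing is smuggled; the point of the split is that the tame piece has a printed owner and that `closes` uses the crux
only at the datum produced by `GrossMomentSharpness`, which may be chosen tame (infinitely many non-anomalous `p ≥ 7`;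
captured `K` in 8 of the route's 10 certificate fields) — after such a restate the wild piece is droppable.
No new definitions.
-/

-- `Summit.<Summit>.<Problem>` is the mandated summit-side namespace (CONVENTIONS §2); for the single-conjunct
-- summit `BirchSwinnertonDyer` the two coincide, so the duplicate is deliberate.
set_option linter.dupNamespace false

namespace Summit.BirchSwinnertonDyer.BirchSwinnertonDyer.Cruxes.FrozenTwinBound.Strategist

open scoped BigOperators

/-- **TAME → WILD → `FrozenTwinBound`.**  The first hypothesis is the crux `FrozenTwin.FrozenTwinBound` restricted to
tame data (`7 ≤ p`, (PO) `¬ p ∣ a_p² - 1`, captured class-group character), the second is the crux on the remaining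
data; the crux follows by cases on the tame side predicate. [folklore] -/
theorem FrozenTwinBound_of_subs :
    (∀ (V : WeierstrassCurve ℚ) [V.IsElliptic] [V.IsGloballyMinimal] (p : ℕ) [Fact p.Prime] (Nplus Nminus m : ℕ) (a b : ℚ) (O : Subring (QuaternionAlgebra ℚ a 0 b)) (K : Type) [Field K] [NumberField K] (ψ : K →ₐ[ℚ] QuaternionAlgebra ℚ a 0 b) (I : Submodule ℤ (QuaternionAlgebra ℚ a 0 b)) (φ : Submodule ℤ (QuaternionAlgebra ℚ a 0 b) → ℤ) (rep : ClassGroup (NumberField.RingOfIntegers K) → nonZeroDivisors (Ideal (NumberField.RingOfIntegers K))) (RI : Set (Submodule ℤ (QuaternionAlgebra ℚ a 0 b))) (σ : ClassGroup (NumberField.RingOfIntegers K)) (dlog : ClassGroup (NumberField.RingOfIntegers K) → ℕ), ((5 ≤ p ∧ V.HasGoodReductionAtPrime p ∧ ¬ (p : ℤ) ∣ V.frobeniusTrace p ∧ V.HasSurjectiveModNGaloisRep p ∧ (∀ q : ℕ, q.Prime → q ∣ V.conductorNorm ℤ → ¬ (p : ℤ) ∣ (q : ℤ) ^ 2 - 1)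 ∧ (∀ (q : ℕ) (_ : Fact q.Prime), V.HasMultiplicativeReductionAtPrime q → ¬ (p : ℤ) ∣ padicValRat q V.j)) ∧ (Module.finrank ℚ K = 2 ∧ NumberField.IsTotallyComplex K ∧ NumberField.discr K < -4 ∧ Int.gcd (NumberField.discr K) (V.conductorNorm ℤ * p) = 1) ∧ (V.conductorNorm ℤ = Nplus * Nminus ∧ Nat.Coprime Nplus Nminus ∧ Squarefree Nminus ∧ Odd Nminus.primeFactors.card ∧ (∀ q : ℕ, q.Prime → q ∣ Nplus → ((Ideal.span {(q : ℤ)}).primesOver (NumberField.RingOfIntegers K)).ncard = 2) ∧ (∀ q : ℕ, q.Prime → q ∣ Nminus → ((Ideal.span {(q : ℤ)}).primesOver (NumberField.RingOfIntegers K)).ncard = 1)) ∧ (a < 0 ∧ b < 0 ∧ (∀ (q : ℕ) [Fact q.Prime], (∀ x : QuaternionAlgebra ℚ_[q] (a : ℚ_[q]) 0 (b : ℚ_[q]), x ≠ 0 → IsUnit x) ↔ q ∣ Nminus)) ∧ (∃ O₁ O₂ : Subring (QuaternionAlgebra ℚ a 0 b), (∀ S : Subring (QuaternionAlgebra ℚ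 a 0 b), (S = O₁ ∨ S = O₂) → (S.toAddSubgroup.FG ∧ (∀ d : QuaternionAlgebra ℚ a 0 b, ∃ n : ℤ, n ≠ 0 ∧ n • d ∈ S) ∧ ∀ S' : Subring (QuaternionAlgebra ℚ a 0 b), S'.toAddSubgroup.FG → S ≤ S' → S' = S)) ∧ O = O₁ ⊓ O₂ ∧ O.toAddSubgroup.relIndex O₁.toAddSubgroup = Nplus) ∧ (∀ J : Submodule ℤ (QuaternionAlgebra ℚ a 0 b), J ∈ RI ↔ (J.FG ∧ (∀ d : QuaternionAlgebra ℚ a 0 b, ∃ n : ℤ, n ≠ 0 ∧ n • d ∈ J) ∧ (∀ x : QuaternionAlgebra ℚ a 0 b, (∀ y ∈ J, y * x ∈ J) ↔ x ∈ O) ∧ (∃ J' : Submodule ℤ (QuaternionAlgebra ℚ a 0 b), (∀ x : QuaternionAlgebra ℚ a 0 b, x ∈ J * J' ↔ ∀ y ∈ J, x * y ∈ J) ∧ (∀ x : QuaternionAlgebra ℚ a 0 b, x ∈ J' * J ↔ x ∈ O)))) ∧ ((∀ J ∈ RI, ∀ β : QuaternionAlgebra ℚ a 0 b, IsUnit β →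 φ (J.map (AddMonoidHom.mulLeft β).toIntLinearMap) = φ J) ∧ (∀ q : ℕ, q.Prime → ¬ q ∣ V.conductorNorm ℤ → ∀ J ∈ RI, ∑ᶠ J' ∈ {J' : Submodule ℤ (QuaternionAlgebra ℚ a 0 b) | J' ≤ J ∧ J'.toAddSubgroup.relIndex J.toAddSubgroup = q ^ 2 ∧ ∀ y ∈ J', ∀ x ∈ O, y * x ∈ J'}, φ J' = (V.frobeniusTrace q : ℤ) * φ J) ∧ (∃ J ∈ RI, ¬ (p : ℤ) ∣ φ J)) ∧ (I ∈ RI ∧ (∀ x : NumberField.RingOfIntegers K, ∀ y ∈ I, ψ (x : K) * y ∈ I) ∧ (∀ x : K, (∀ y ∈ I, ψ x * y ∈ I) → ∃ z : NumberField.RingOfIntegers K, (z : K) = x) ∧ (∀ 𝔞 : ClassGroup (NumberField.RingOfIntegers K), ClassGroup.mk0 (rep 𝔞) = 𝔞) ∧ (∀ 𝔞 : ClassGroup (NumberField.RingOfIntegers K), Submodule.span ℤ ((fun x : NumberField.RingOfIntegers K => ψ (x : K)) '' ((rep 𝔞 : nonZeroDivisors (Ideal (NumberField.RingOfIntegers K)))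 : Ideal (NumberField.RingOfIntegers K))) * I ∈ RI)) ∧ (1 ≤ m ∧ orderOf σ = p ^ m ∧ ¬ p ^ (m + 1) ∣ Fintype.card (ClassGroup (NumberField.RingOfIntegers K)) ∧ (∀ 𝔞 : ClassGroup (NumberField.RingOfIntegers K), dlog 𝔞 < p ^ m ∧ Nat.Coprime (orderOf (𝔞 * (σ ^ dlog 𝔞)⁻¹)) p))) → (7 ≤ p ∧ ¬ (p : ℤ) ∣ V.frobeniusTrace p ^ 2 - 1 ∧ (∀ (c : K ≃ₐ[ℚ] K), c ≠ AlgEquiv.refl → ∀ (𝔟 : nonZeroDivisors (Ideal (NumberField.RingOfIntegers K))) (t : NumberField.RingOfIntegers K), ClassGroup.mk0 𝔟 = σ → IsCoprime (𝔟 : Ideal (NumberField.RingOfIntegers K)) (Ideal.span {(p : NumberField.RingOfIntegers K)}) → (𝔟 : Ideal (NumberField.RingOfIntegers K)) ^ (p ^ m) = Ideal.span {t} → ¬ ∃ z : NumberField.RingOfIntegers K, (t : K) ^ (p ^ 2 - 1) - c ((t : K) ^ (p ^ 2 - 1)) = (p : K) ^ (m + 1) * (z : K))) → ∀ k : ℕ,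 k + 2 ≤ p → ¬ (p : ℤ) ∣ ∑ 𝔞 : ClassGroup (NumberField.RingOfIntegers K), ((dlog 𝔞).choose k : ℤ) * φ (Submodule.span ℤ ((fun x : NumberField.RingOfIntegers K => ψ (x : K)) '' ((rep 𝔞 : nonZeroDivisors (Ideal (NumberField.RingOfIntegers K))) : Ideal (NumberField.RingOfIntegers K))) * I) → V.selmerCorank p ≤ k) →
    (∀ (V : WeierstrassCurve ℚ) [V.IsElliptic] [V.IsGloballyMinimal] (p : ℕ) [Fact p.Prime] (Nplus Nminus m : ℕ) (a b : ℚ) (O : Subring (QuaternionAlgebra ℚ a 0 b)) (K : Type) [Field K] [NumberField K] (ψ : K →ₐ[ℚ] QuaternionAlgebra ℚ a 0 b) (I : Submodule ℤ (QuaternionAlgebra ℚ a 0 b)) (φ : Submodule ℤ (QuaternionAlgebra ℚ a 0 b) → ℤ) (rep : ClassGroup (NumberField.RingOfIntegers K) → nonZeroDivisors (Ideal (NumberField.RingOfIntegers K))) (RI : Set (Submodule ℤ (QuaternionAlgebra ℚ a 0 b))) (σ : ClassGroup (NumberField.RingOfIntegers K)) (dlog : ClassGroup (NumberField.RingOfIntegers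 K) → ℕ), ((5 ≤ p ∧ V.HasGoodReductionAtPrime p ∧ ¬ (p : ℤ) ∣ V.frobeniusTrace p ∧ V.HasSurjectiveModNGaloisRep p ∧ (∀ q : ℕ, q.Prime → q ∣ V.conductorNorm ℤ → ¬ (p : ℤ) ∣ (q : ℤ) ^ 2 - 1) ∧ (∀ (q : ℕ) (_ : Fact q.Prime), V.HasMultiplicativeReductionAtPrime q → ¬ (p : ℤ) ∣ padicValRat q V.j)) ∧ (Module.finrank ℚ K = 2 ∧ NumberField.IsTotallyComplex K ∧ NumberField.discr K < -4 ∧ Int.gcd (NumberField.discr K) (V.conductorNorm ℤ * p) = 1) ∧ (V.conductorNorm ℤ = Nplus * Nminus ∧ Nat.Coprime Nplus Nminus ∧ Squarefree Nminus ∧ Odd Nminus.primeFactors.card ∧ (∀ q : ℕ, q.Prime → q ∣ Nplus → ((Ideal.span {(q : ℤ)}).primesOver (NumberField.RingOfIntegers K)).ncard = 2) ∧ (∀ q : ℕ, q.Prime → q ∣ Nminus → ((Ideal.span {(q : ℤ)}).primesOver (NumberField.RingOfIntegers K)).ncard = 1)) ∧ (a < 0 ∧ b < 0 ∧ (∀ (q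 : ℕ) [Fact q.Prime], (∀ x : QuaternionAlgebra ℚ_[q] (a : ℚ_[q]) 0 (b : ℚ_[q]), x ≠ 0 → IsUnit x) ↔ q ∣ Nminus)) ∧ (∃ O₁ O₂ : Subring (QuaternionAlgebra ℚ a 0 b), (∀ S : Subring (QuaternionAlgebra ℚ a 0 b), (S = O₁ ∨ S = O₂) → (S.toAddSubgroup.FG ∧ (∀ d : QuaternionAlgebra ℚ a 0 b, ∃ n : ℤ, n ≠ 0 ∧ n • d ∈ S) ∧ ∀ S' : Subring (QuaternionAlgebra ℚ a 0 b), S'.toAddSubgroup.FG → S ≤ S' → S' = S)) ∧ O = O₁ ⊓ O₂ ∧ O.toAddSubgroup.relIndex O₁.toAddSubgroup = Nplus) ∧ (∀ J : Submodule ℤ (QuaternionAlgebra ℚ a 0 b), J ∈ RI ↔ (J.FG ∧ (∀ d : QuaternionAlgebra ℚ a 0 b, ∃ n : ℤ, n ≠ 0 ∧ n • d ∈ J) ∧ (∀ x : QuaternionAlgebra ℚ a 0 b, (∀ y ∈ J, y * x ∈ J) ↔ x ∈ O) ∧ (∃ J' : Submodule ℤ (QuaternionAlgebra ℚ a 0 b),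 (∀ x : QuaternionAlgebra ℚ a 0 b, x ∈ J * J' ↔ ∀ y ∈ J, x * y ∈ J) ∧ (∀ x : QuaternionAlgebra ℚ a 0 b, x ∈ J' * J ↔ x ∈ O)))) ∧ ((∀ J ∈ RI, ∀ β : QuaternionAlgebra ℚ a 0 b, IsUnit β → φ (J.map (AddMonoidHom.mulLeft β).toIntLinearMap) = φ J) ∧ (∀ q : ℕ, q.Prime → ¬ q ∣ V.conductorNorm ℤ → ∀ J ∈ RI, ∑ᶠ J' ∈ {J' : Submodule ℤ (QuaternionAlgebra ℚ a 0 b) | J' ≤ J ∧ J'.toAddSubgroup.relIndex J.toAddSubgroup = q ^ 2 ∧ ∀ y ∈ J', ∀ x ∈ O, y * x ∈ J'}, φ J' = (V.frobeniusTrace q : ℤ) * φ J) ∧ (∃ J ∈ RI, ¬ (p : ℤ) ∣ φ J)) ∧ (I ∈ RI ∧ (∀ x : NumberField.RingOfIntegers K, ∀ y ∈ I, ψ (x : K) * y ∈ I) ∧ (∀ x : K, (∀ y ∈ I, ψ x * y ∈ I) → ∃ z : NumberField.RingOfIntegers K, (z : K) = x) ∧ (∀ 𝔞 : ClassGroup (NumberField.RingOfIntegers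 K), ClassGroup.mk0 (rep 𝔞) = 𝔞) ∧ (∀ 𝔞 : ClassGroup (NumberField.RingOfIntegers K), Submodule.span ℤ ((fun x : NumberField.RingOfIntegers K => ψ (x : K)) '' ((rep 𝔞 : nonZeroDivisors (Ideal (NumberField.RingOfIntegers K))) : Ideal (NumberField.RingOfIntegers K))) * I ∈ RI)) ∧ (1 ≤ m ∧ orderOf σ = p ^ m ∧ ¬ p ^ (m + 1) ∣ Fintype.card (ClassGroup (NumberField.RingOfIntegers K)) ∧ (∀ 𝔞 : ClassGroup (NumberField.RingOfIntegers K), dlog 𝔞 < p ^ m ∧ Nat.Coprime (orderOf (𝔞 * (σ ^ dlog 𝔞)⁻¹)) p))) → ¬ (7 ≤ p ∧ ¬ (p : ℤ) ∣ V.frobeniusTrace p ^ 2 - 1 ∧ (∀ (c : K ≃ₐ[ℚ] K), c ≠ AlgEquiv.refl → ∀ (𝔟 : nonZeroDivisors (Ideal (NumberField.RingOfIntegers K))) (t : NumberField.RingOfIntegers K), ClassGroup.mk0 𝔟 = σ → IsCoprime (𝔟 : Ideal (NumberField.RingOfIntegers K)) (Ideal.span {(p : NumberField.RingOfIntegers K)})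 → (𝔟 : Ideal (NumberField.RingOfIntegers K)) ^ (p ^ m) = Ideal.span {t} → ¬ ∃ z : NumberField.RingOfIntegers K, (t : K) ^ (p ^ 2 - 1) - c ((t : K) ^ (p ^ 2 - 1)) = (p : K) ^ (m + 1) * (z : K))) → ∀ k : ℕ, k + 2 ≤ p → ¬ (p : ℤ) ∣ ∑ 𝔞 : ClassGroup (NumberField.RingOfIntegers K), ((dlog 𝔞).choose k : ℤ) * φ (Submodule.span ℤ ((fun x : NumberField.RingOfIntegers K => ψ (x : K)) '' ((rep 𝔞 : nonZeroDivisors (Ideal (NumberField.RingOfIntegers K))) : Ideal (NumberField.RingOfIntegers K))) * I) → V.selmerCorank p ≤ k) →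
    Summit.BirchSwinnertonDyer.BirchSwinnertonDyer.Theses.FrozenTwin.FrozenTwinBound := by
  intro hT hW V _ _ p _ Nplus Nminus m a b O K _ _ ψ I φ rep RI σ dlog hH k hkp hndvd
  by_cases hP : (7 ≤ p ∧ ¬ (p : ℤ) ∣ V.frobeniusTrace p ^ 2 - 1 ∧ (∀ (c : K ≃ₐ[ℚ] K), c ≠ AlgEquiv.refl → ∀ (𝔟 : nonZeroDivisors (Ideal (NumberField.RingOfIntegers K))) (t : NumberField.RingOfIntegers K), ClassGroup.mk0 𝔟 = σ → IsCoprime (𝔟 : Ideal (NumberField.RingOfIntegers K)) (Ideal.span {(p : NumberField.RingOfIntegers K)}) → (𝔟 : Ideal (NumberField.RingOfIntegers K)) ^ (p ^ m) = Ideal.span {t} → ¬ ∃ z : NumberField.RingOfIntegers K, (t : K) ^ (p ^ 2 - 1) - c ((t : K) ^ (p ^ 2 - 1)) = (p : K) ^ (m + 1) * (z : K)))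
  · exact hT V p Nplus Nminus m a b O K ψ I φ rep RI σ dlog hH hP k hkp hndvd
  · exact hW V p Nplus Nminus m a b O K ψ I φ rep RI σ dlog hH hP k hkp hndvd

end Summit.BirchSwinnertonDyer.BirchSwinnertonDyer.Cruxes.FrozenTwinBound.Strategist
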